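import Summits.PneNP.PneNP.Theorems.ChebyshevTracialDesignGammaDirectionLeibnizBounds
import Summits.PneNP.PneNP.Theorems.ChebyshevTracialDesignGammaDirectionCentredMoments
import Literature.Combinatorics.Optimization.ShellLawCentredMomentFirstOrder
import HarnessLib

/-!
# Cell pnp-psdrank, route `ChebyshevTracialDesign`: the centred second moment's level-smoothness sum from per-order law budgets
# (crux `TracialDecayExp20`, stmt-PneNP-19878)

Brick 136 (prover g27; MEMO-30 rev 2 §3b). Hypothesis (ii) of brick 130's centred-basis criterion asks, at a bulk point `x`, for
`Σ_{k=1}^{D} c_k|Δ^k_j A^m_{2j+1}(x)(0)| ≤ ε_A·A^m_1(x)`, `A^m_c(x) = E_c[1_{X=x}(n_A − m)²]`, `c_k = C(2k,k)/4^k`. This file assembles the LEFT side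
from the two legs now in the tree:
* the `k = 1` term — Literature `ShellStep.abs_centredSecond_three_sub_one_le` (prover g27: Leibniz-first split, `main_one_eq`, weighted pointwise
  `x`-smoothness, pinned sub-sums, discharge by type): `c₁|ΔA^m(0)| = ½|A^m_3(x) − A^m_1(x)| ≤ ½·FIRST`, `FIRST` explicit in `A^m_1(x)`, the factorial
  sections `F²_1(x)`, `F¹_1(x)`, `|B^m_3(x)|`, `law_3(x)` and the level-`1` constants `E ≥ E₁(N₀−2)`, `Far ≥ 4e^{−(L−2)²/(4(N₀−2))}`;
* the orders `k ≥ 2` — brick 135 §4 `sum_abs_fwdDiff_iter_threeLaw_le_of_one` (eng g25; TERMWISE from per-order budgets `R₀, R₁, R₂` of the three law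
  profiles `G₀(j) = law(2r+7,2j+1;x)`, `G₁(j) = Σ_v law_{[n]∖e_v}(2r+5,2j+1;x−2)`, `G₂(j) = Σ_{v≠w} law_{[n]∖e_v∖e_w}(2r+3,2j+1;x−4)`), the three-law
  form of `A^m` at every odd level being Literature `weightedSection_eq_laws` + `centredSq_section_eq`.

* **`sum_abs_fwdDiff_centredSecond_le_of_budgets`**: for a perfect matching `M` on `Fin n`, a block `H` of type `(a,b,d)` (`a+b+d = N₀`), cut
  `2r+7`, orders `D` with `2D ≤ 2r+6` and `2r+8+2D ≤ n`, a point `1 ≤ x` in the window, a real centring `m`, the hypotheses of the `k = 1` leg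
  (margins `b,d ≥ βN₀+3`, `βN₀ ≤ r+2`, `8(r+2) ≤ (4+β)(N₀−2)`, `§7`-numerics at `N₀−2`) and budgets `c_i|Δ^iG_r(0)| ≤ R_r(i)` (`i ≤ D`):
  `Σ_{k∈[1,D]} c_k|Δ^k A^m(0)| ≤ ½·FIRST + Σ_{k∈[2,D]} [T(T−2)/K·R₂(k) + 4k(T−2)/K·(R₂(k−1)+R₂(k)) + 8C(k,2)/K·(R₂(k−2)+2R₂(k−1)+R₂(k))
     + |1−2m|(T/n·R₁(k) + 2k/n·(R₁(k−1)+R₁(k))) + m²R₀(k)]`, `T = 2r+6`, `K = n(n−2)`.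
READING: dividing by the variance floor (V) `A^m_1(x) ≥ (r_V²/2)·law_1(x)` (lit g38: `ShellStep.centredSq_section_ge_of_brackets`) and feeding
`R_r(i) = Γq^i·G_r(0) + tails` (Lq `abs_fwdDiff_iter_shellLaw_le_of_hyps` on `[n]` and — eng g25 — on the deleted ground sets) gives hypothesis (hA) of
brick 130 with `ε_A = O(E₁ + 1/N + η₁ + N·q²)` → 0 in the cell's regime; `B^m_3 = Δ_cB^m(1)` is brick 133 at `k = 1` once `m = E_1[n_A|X=x]`.
WHAT THIS FILE DOES NOT DO: supply the budgets, (V), the centring, the asymptotic numerics, anything on `TracialDecayExp20` itself, psd rank of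
P_PM(K_n), or P vs NP. [cite: Rothvoss2017, §2 (PDF p. 6)] [cite: RollinRoss2010, §3 (Lemma 3.3), §4.1 Thm 4.2] [cite: Boole2009, Ch. II Art. 10 Ex. 3 eq. (8)]
Stature: support/instrument (kernel lane, no defs, axioms standard; constants asymptotic only). Supports stmt-PneNP-19878.
-/

set_option linter.dupNamespace false -- `Summit.PneNP.PneNP.…`: summit = sub-problem (D-0017)

noncomputable section

namespace Summit.PneNP.PneNP.Theorems.ChebyshevTracialDesignGammaDirectionSecondMomentBudget

open Finset Polynomial Literature.Barriers.PneNP Literature.Combinatorics.Optimization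
open Literature.Combinatorics.Optimization.ShellStep
open Summit.PneNP.PneNP.Theorems.ChebyshevTracialDesignShellOperatorForm (shell_partner_nonempty)
open Summit.PneNP.PneNP.Theorems.ChebyshevTracialDesignGammaDirectionLeibnizBounds (sum_abs_fwdDiff_iter_threeLaw_le_of_one)

variable {n : ℕ}

/-- **THE LEVEL-SMOOTHNESS SUM OF THE CENTRED SECOND MOMENT FROM PER-ORDER LAW BUDGETS** (brick 136; see the module docstring for the reading and
for what is NOT here). [cite: Rothvoss2017, §2 (PDF p. 6)] [cite: RollinRoss2010, §3 (Lemma 3.3), §4.1 Thm 4.2]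
[cite: Boole2009, Ch. II Art. 10 Ex. 3 eq. (8)] -/
theorem sum_abs_fwdDiff_centredSecond_le_of_budgets (M : PMatch n) (H : Finset (Fin n)) {a b d N₀ : ℕ}
    (ha : (reps M.2.partner (vAA M.2.partner univ H)).card = a)
    (hb : (reps M.2.partner (vBH M.2.partner univ H ∪ vBN M.2.partner univ H)).card = b)
    (hd : (reps M.2.partner (vDD M.2.partner univ H)).card = d) (hN : a + b + d = N₀)
    {β : ℝ} (hβ : 0 < β) (hβ1 : β ≤ 1) (hbβ : β * N₀ + 3 ≤ b) (hdβ : β * N₀ + 3 ≤ d)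
    {r : ℕ} (hs : β * N₀ ≤ (r : ℝ) + 2) (hs' : 8 * ((r : ℝ) + 2) ≤ (4 + β) * ((N₀ : ℝ) - 2)) (hrN : r + 4 ≤ N₀)
    (hN16 : 16 ≤ N₀) (hn4 : 4 ≤ n) {D : ℕ} (hD1 : 1 ≤ D) (hDr : 2 * D ≤ 2 * r + 6) (hDn : 2 * r + 1 + 6 + (2 * D + 1) ≤ n)
    {x : ℕ} (hx1 : 1 ≤ x) {ε : ℝ}
    (hxε : |(x : ℝ) - (2 * ((r : ℝ) + 3) + 1) * (2 * a + b) / (2 * N₀)| ≤ ε)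
    {L : ℝ} (h2L : 2 ≤ L) (hLN : L - 2 ≤ 2 * ((N₀ : ℝ) - 2))
    (hL1 : L + 1 + (ε + 15) ≤ β * ((r : ℝ) + 2)) (hL2 : L + 1 + (ε + 15) + 3 ≤ β * ((N₀ : ℝ) - 2) / 8)
    (hwin : 2 * (L + 1 + 1) ≤ (β ^ 2 / 8) ^ 2 * (β * ((N₀ : ℝ) - 2))) (hN4 : 4 ≤ β * ((N₀ : ℝ) - 2))
    (hkV : (1 : ℝ) * (1 + 8 * (L + 1 + 1) / ((β ^ 2 / 8) ^ 4 * (β * ((N₀ : ℝ) - 2)))) ≤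
      (β ^ 2 / 8) ^ 4 * (β * ((N₀ : ℝ) - 2)))
    (m : ℝ) (P₁ P₂ P₃ : Finset (Fin n) → ℕ → ℤ → ℝ)
    (hP₁ : ∀ T t' y, P₁ T t' y = (∑ U ∈ ((shellIn M.2.partner T t' 1).filter fun U => ((U ∩ H).card : ℤ) = y),
        (((((reps M.2.partner (vAA M.2.partner T H)).filter fun v => v ∈ U ∧ M.2.partner v ∈ U).card : ℕ) : ℝ) - m) ^ 2) /
        ((shellIn M.2.partner T t' 1).card : ℝ))
    (hP₂ : ∀ T t' y, P₂ T t' y = (∑ U ∈ ((shellIn M.2.partner T t' 1).filter fun U => ((U ∩ H).card : ℤ) = y),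
        (((((reps M.2.partner (vAA M.2.partner T H)).filter fun v => v ∈ U ∧ M.2.partner v ∈ U).card : ℕ) : ℝ) *
          (((((reps M.2.partner (vAA M.2.partner T H)).filter fun v => v ∈ U ∧ M.2.partner v ∈ U).card : ℕ) : ℝ) - 1))) /
        ((shellIn M.2.partner T t' 1).card : ℝ))
    (hP₃ : ∀ T t' y, P₃ T t' y = (∑ U ∈ ((shellIn M.2.partner T t' 1).filter fun U => ((U ∩ H).card : ℤ) = y),
        ((((reps M.2.partner (vAA M.2.partner T H)).filter fun v => v ∈ U ∧ M.2.partner v ∈ U).card : ℕ) : ℝ)) /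
        ((shellIn M.2.partner T t' 1).card : ℝ))
    {E Far : ℝ} (hE0 : 0 ≤ E) (hFar0 : 0 ≤ Far)
    (hE : (((1 + 8 * (L + 1 + 1) / ((β ^ 2 / 8) ^ 4 * (β * ((N₀ : ℝ) - 2)))) *
            (8 * (L + 1 + 1) / ((β ^ 2 / 8) ^ 4 * (β * ((N₀ : ℝ) - 2))) +
              2 * Real.sqrt 192 * Real.sqrt (2 * (2 * (1 : ℝ) + 1) *
                (1 + 8 * (L + 1 + 1) / ((β ^ 2 / 8) ^ 4 * (β * ((N₀ : ℝ) - 2)))) /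
                  ((β ^ 2 / 8) ^ 4 * (β * ((N₀ : ℝ) - 2)))))) ^ (2 * 1) *
          (1 + 4 * (Real.sqrt ((N₀ : ℝ) - 2) + 1) / 3 *
            (2 * Real.sqrt 192 * Real.sqrt (2 * (2 * (1 : ℝ) + 1) *
              (1 + 8 * (L + 1 + 1) / ((β ^ 2 / 8) ^ 4 * (β * ((N₀ : ℝ) - 2)))) /
                ((β ^ 2 / 8) ^ 4 * (β * ((N₀ : ℝ) - 2))))))) ≤ E)
    (hFar : (4 : ℝ) ^ 1 * Real.exp (-((L - 2 * 1) ^ 2 / (4 * ((N₀ : ℝ) - 2)))) ≤ Far)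
    (R₀ R₁ R₂ : ℕ → ℝ)
    (hR₀ : ∀ i, i ≤ D → (((2 * i).choose i : ℕ) : ℝ) / (4 : ℝ) ^ i *
      |(fwdDiff (1 : ℕ))^[i] (fun j : ℕ => shellLaw M.2.partner univ H (2 * r + 1 + 6) (2 * j + 1) x) 0| ≤ R₀ i)
    (hR₁ : ∀ i, i ≤ D → (((2 * i).choose i : ℕ) : ℝ) / (4 : ℝ) ^ i *
      |(fwdDiff (1 : ℕ))^[i] (fun j : ℕ => ∑ v ∈ reps M.2.partner (vAA M.2.partner univ H),
        shellLaw M.2.partner (univ \ {v, M.2.partner v}) H (2 * r + 3 + 2) (2 * j + 1) (x - 2)) 0| ≤ R₁ i)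
    (hR₂ : ∀ i, i ≤ D → (((2 * i).choose i : ℕ) : ℝ) / (4 : ℝ) ^ i *
      |(fwdDiff (1 : ℕ))^[i] (fun j : ℕ => ∑ v ∈ reps M.2.partner (vAA M.2.partner univ H),
        ∑ w ∈ (reps M.2.partner (vAA M.2.partner univ H)).erase v,
          shellLaw M.2.partner (del2 M.2.partner univ v w) H (2 * r + 3) (2 * j + 1) (x - 4)) 0| ≤ R₂ i) :
    ∑ k ∈ Ico 1 (D + 1), (((2 * k).choose k : ℕ) : ℝ) / (4 : ℝ) ^ k *
        |(fwdDiff (1 : ℕ))^[k] (fun j : ℕ =>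
          (∑ U ∈ ((shellIn M.2.partner univ (2 * r + 1 + 6) (2 * j + 1)).filter fun U => ((U ∩ H).card : ℤ) = x),
            (((((reps M.2.partner (vAA M.2.partner univ H)).filter fun v => v ∈ U ∧ M.2.partner v ∈ U).card : ℕ) : ℝ) - m) ^ 2) /
            ((shellIn M.2.partner univ (2 * r + 1 + 6) (2 * j + 1)).card : ℝ)) 0| ≤
      (1 / 2 : ℝ) *
        (((((vAA M.2.partner univ H).card : ℝ) * (vDD M.2.partner univ H).card +
              ∑ p ∈ vBH M.2.partner univ H, (((vBN M.2.partner univ H).erase (M.2.partner p)).card : ℝ)) /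
            (((univ : Finset (Fin n)).card : ℝ) * (((univ : Finset (Fin n)).card : ℝ) - 2))) *
          (E * ((((univ : Finset (Fin n)).card : ℝ) * (((univ : Finset (Fin n)).card : ℝ) - 2)) /
                (((((2 * r + 1 : ℕ) : ℕ) : ℝ) + 6 - ((1 : ℕ) : ℝ)) *
                  (((univ : Finset (Fin n)).card : ℝ) - (((2 * r + 1 : ℕ) : ℕ) + 6) - ((1 : ℕ) : ℝ)))) *
              (P₁ univ (2 * r + 1 + 6) x +
                (((((2 * r + 1 : ℕ) : ℕ) : ℝ) + 6 - ((1 : ℕ) : ℝ)) / ((((2 * r + 1 : ℕ) : ℕ) : ℝ) + 2 - ((1 : ℕ) : ℝ)) - 1) *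
                  P₂ univ (2 * r + 1 + 6) x +
                (((((2 * r + 1 : ℕ) : ℕ) : ℝ) + 6 - ((1 : ℕ) : ℝ)) / ((((2 * r + 1 : ℕ) : ℕ) : ℝ) + 4 - ((1 : ℕ) : ℝ)) - 1) * |1 - 2 * m| *
                  P₃ univ (2 * r + 1 + 6) x) +
            ((((r : ℝ) + 2) + |m|) ^ 2 * Far +
              (((((2 * r + 1 : ℕ) : ℕ) : ℝ) + 6 - ((1 : ℕ) : ℝ)) / ((((2 * r + 1 : ℕ) : ℕ) : ℝ) + 2 - ((1 : ℕ) : ℝ)) - 1) *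
                (((r : ℝ) + 2) ^ 2 * Far) +
              (((((2 * r + 1 : ℕ) : ℕ) : ℝ) + 6 - ((1 : ℕ) : ℝ)) / ((((2 * r + 1 : ℕ) : ℕ) : ℝ) + 4 - ((1 : ℕ) : ℝ)) - 1) * |1 - 2 * m| *
                (((r : ℝ) + 2) * Far))) +
        (4 / ((((2 * r + 1 : ℕ) : ℕ) : ℝ) + 2 - ((1 : ℕ) : ℝ))) * P₁ univ (2 * r + 1 + 6) x +
        abs (2 * m - 1) * (2 * ((((2 * r + 1 : ℕ) : ℕ) : ℝ) + 6 - ((1 : ℕ) : ℝ)) /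
            (((((2 * r + 1 : ℕ) : ℕ) : ℝ) + 4 - ((1 : ℕ) : ℝ)) * ((((2 * r + 1 : ℕ) : ℕ) : ℝ) + 2 - ((1 : ℕ) : ℝ)))) *
          abs ((∑ U ∈ ((shellIn M.2.partner (univ : Finset (Fin n)) (2 * r + 1 + 6) (1 + 2)).filter
              fun U => ((U ∩ H).card : ℤ) = x),
              (((((reps M.2.partner (vAA M.2.partner univ H)).filter fun v => v ∈ U ∧ M.2.partner v ∈ U).card : ℕ) : ℝ) - m)) /
              ((shellIn M.2.partner (univ : Finset (Fin n)) (2 * r + 1 + 6) (1 + 2)).card : ℝ)) +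
        (abs (2 * m * (4 * m + ((1 : ℕ) : ℝ) - ((2 * r + 1 : ℕ) : ℕ) - 6)) /
            (((((2 * r + 1 : ℕ) : ℕ) : ℝ) + 4 - ((1 : ℕ) : ℝ)) * ((((2 * r + 1 : ℕ) : ℕ) : ℝ) + 2 - ((1 : ℕ) : ℝ)))) *
          shellLaw M.2.partner univ H (2 * r + 1 + 6) (1 + 2) x) +
      ∑ k ∈ Ico 2 (D + 1), (|(1 : ℝ)| * ((2 * (r : ℝ) + 6) * ((2 * (r : ℝ) + 6) - 2) / ((n : ℝ) * ((n : ℝ) - 2)) * R₂ k +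
            4 * (k : ℝ) * ((2 * (r : ℝ) + 6) - 2) / ((n : ℝ) * ((n : ℝ) - 2)) * (R₂ (k - 1) + R₂ k) +
            8 * ((k.choose 2 : ℕ) : ℝ) / ((n : ℝ) * ((n : ℝ) - 2)) * (R₂ (k - 2) + 2 * R₂ (k - 1) + R₂ k)) +
          |1 - 2 * m| * ((2 * (r : ℝ) + 6) / (n : ℝ) * R₁ k + 2 * (k : ℝ) / (n : ℝ) * (R₁ (k - 1) + R₁ k)) +
          |m ^ 2| * R₀ k) := by
  classical
  set π := M.2.partner with hπdef
  have hπ : ∀ v, π (π v) = v := partner_partner M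
  have hπ' : ∀ v, π v ≠ v := partner_ne M
  have hst : ∀ v ∈ (univ : Finset (Fin n)), π v ∈ univ := fun v _ => mem_univ _
  have hncard : ((univ : Finset (Fin n)).card : ℝ) = n := by rw [card_univ, Fintype.card_fin]
  have hn4r : (4 : ℝ) ≤ n := by exact_mod_cast hn4
  -- nonempty shells at the odd levels `2j+1 ≤ 2D+1`
  have hne : ∀ j, j ≤ D → (shellIn π univ (2 * r + 1 + 6) (2 * j + 1)).Nonempty := by
    intro j hj
    rw [shellIn_univ]
    exact shell_partner_nonempty M ⟨r + 3, by ring⟩ ⟨j, by ring⟩ (by omega) (by omega)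
  -- the three-law form at every level `2j+1`, `j ≤ D`
  have hF : ∀ j, j ≤ D →
      (∑ U ∈ ((shellIn π univ (2 * r + 1 + 6) (2 * j + 1)).filter fun U => ((U ∩ H).card : ℤ) = x),
          (((((reps π (vAA π univ H)).filter fun v => v ∈ U ∧ π v ∈ U).card : ℕ) : ℝ) - m) ^ 2) /
          ((shellIn π univ (2 * r + 1 + 6) (2 * j + 1)).card : ℝ) =
        1 * ((((2 * (r : ℝ) + 6) - 2 * (j : ℝ)) * ((2 * (r : ℝ) + 6) - 2 - 2 * (j : ℝ))) / ((n : ℝ) * ((n : ℝ) - 2))) *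
            (∑ v ∈ reps π (vAA π univ H), ∑ w ∈ (reps π (vAA π univ H)).erase v,
              shellLaw π (del2 π univ v w) H (2 * r + 3) (2 * j + 1) (x - 4)) +
          (1 - 2 * m) * (((2 * (r : ℝ) + 6) - 2 * (j : ℝ)) / (n : ℝ)) *
            (∑ v ∈ reps π (vAA π univ H), shellLaw π (univ \ {v, π v}) H (2 * r + 3 + 2) (2 * j + 1) (x - 2)) +
          m ^ 2 * shellLaw π univ H (2 * r + 1 + 6) (2 * j + 1) x := by
    intro j hj
    have hnej : (shellIn π univ (2 * r + 3 + 4) (2 * j + 1)).Nonempty := hne j hj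
    have h3 := weightedSection_eq_laws hπ hπ' hst H hnej 1 (1 - 2 * m) (m ^ 2) x
    rw [show 2 * r + 3 + 4 = 2 * r + 1 + 6 by ring] at h3
    rw [centredSq_section_eq, h3, hncard]
    push_cast
    ring
  -- the `k = 1` term
  have hfirst := abs_centredSecond_three_sub_one_le hπ hπ' H ha hb hd hN hβ hβ1 hbβ hdβ hs hs' hrN hN16 (hne 1 hD1) hx1 hxε h2L
    hLN hL1 hL2 hwin hN4 hkV m P₁ P₂ P₃ hP₁ hP₂ hP₃ hE0 hFar0 hE hFar
  have e0 : (∑ U ∈ ((shellIn π univ (2 * r + 1 + 6) 1).filter fun U => ((U ∩ H).card : ℤ) = x),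
        (((((reps π (vAA π univ H)).filter fun v => v ∈ U ∧ π v ∈ U).card : ℕ) : ℝ) - m) ^ 2) /
        ((shellIn π univ (2 * r + 1 + 6) 1).card : ℝ) = P₁ univ (2 * r + 1 + 6) x := by rw [hP₁]
  have h1 := mul_le_mul_of_nonneg_left hfirst (by norm_num : (0 : ℝ) ≤ 1 / 2)
  have e1 : (((2 * 1).choose 1 : ℕ) : ℝ) / (4 : ℝ) ^ 1 *
      |(fwdDiff (1 : ℕ))^[1] (fun j : ℕ =>
        (∑ U ∈ ((shellIn π univ (2 * r + 1 + 6) (2 * j + 1)).filter fun U => ((U ∩ H).card : ℤ) = x),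
          (((((reps π (vAA π univ H)).filter fun v => v ∈ U ∧ π v ∈ U).card : ℕ) : ℝ) - m) ^ 2) /
          ((shellIn π univ (2 * r + 1 + 6) (2 * j + 1)).card : ℝ)) 0| =
      1 / 2 * |(∑ U ∈ ((shellIn π (univ : Finset (Fin n)) (2 * r + 1 + 6) (1 + 2)).filter fun U => ((U ∩ H).card : ℤ) = x),
          (((((reps π (vAA π univ H)).filter fun v => v ∈ U ∧ π v ∈ U).card : ℕ) : ℝ) - m) ^ 2) /
          ((shellIn π (univ : Finset (Fin n)) (2 * r + 1 + 6) (1 + 2)).card : ℝ) - P₁ univ (2 * r + 1 + 6) x| := by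
    have ec : (((2 * 1).choose 1 : ℕ) : ℝ) / (4 : ℝ) ^ 1 = 1 / 2 := by norm_num
    rw [ec, Function.iterate_one, fwdDiff_one_apply, ← e0]
  rw [← e1] at h1
  have hmain := sum_abs_fwdDiff_iter_threeLaw_le_of_one
    (fun j : ℕ => (∑ U ∈ ((shellIn π univ (2 * r + 1 + 6) (2 * j + 1)).filter fun U => ((U ∩ H).card : ℤ) = x),
          (((((reps π (vAA π univ H)).filter fun v => v ∈ U ∧ π v ∈ U).card : ℕ) : ℝ) - m) ^ 2) /
          ((shellIn π univ (2 * r + 1 + 6) (2 * j + 1)).card : ℝ))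
    (fun j : ℕ => ∑ v ∈ reps π (vAA π univ H), ∑ w ∈ (reps π (vAA π univ H)).erase v,
        shellLaw π (del2 π univ v w) H (2 * r + 3) (2 * j + 1) (x - 4))
    (fun j : ℕ => ∑ v ∈ reps π (vAA π univ H), shellLaw π (univ \ {v, π v}) H (2 * r + 3 + 2) (2 * j + 1) (x - 2))
    (fun j : ℕ => shellLaw π univ H (2 * r + 1 + 6) (2 * j + 1) x)
    (2 * (r : ℝ) + 6) ((n : ℝ) * ((n : ℝ) - 2)) (n : ℝ) 1 (1 - 2 * m) (m ^ 2) (by linarith)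
    (mul_pos (by linarith) (by linarith)) (by linarith) D hF R₀ R₁ R₂ hR₀ hR₁ hR₂ h1
  exact hmain

end Summit.PneNP.PneNP.Theorems.ChebyshevTracialDesignGammaDirectionSecondMomentBudget

end
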